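import Literature.MathematicalPhysics.QuantumFieldTheory.Balaban1983to89.B9Eq365QGGQLowerVariational
import Literature.MathematicalPhysics.QuantumFieldTheory.Balaban1983to89.B9Eq319BlockPedestalLift

/-!
# `Balaban1983to89.B9Eq365QGGQLowerVariationalSharp` — T. Bałaban, *Propagators for lattice gauge theories in a background field*, Commun.
# Math. Phys. **99** (1985) 389–434 [Balaban1985BackgroundPropagators] Thm 3.11 p. 416 with (3.25) p. 394: **A SHARPER, VOLUME-FREE LOWER
# BOUND FOR THE THIRD OPERATOR `Q′G′²Q′*` OF THM 3.11 AT THE FLAT BACKGROUND — `κ♯·‖ψ‖² ≤ ⟪ψ, Q̃′G′(1)²Q̃′†ψ⟫` WITH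
# `κ♯ ≥ ρ∕(12d(6∕5)^{d−1}ρ(ηL)⁻² + a′)²` FOR EVERY `L ≥ 1` (`ρ = c₀L^d∕c₁`), I.E. `(12d(6∕5)^{d−1} + a′)⁻²` ON THE DIAGONAL: `1.42·10⁻⁴` AT
# `d = 4`, `a′ = 1`, AGAINST `1.3·10⁻¹⁷` OF `B9Eq365QGGQLowerVariational.qggq_constant_diagonal_ge`** — the same first-order variational
# principle at the tent ON A PEDESTAL `c = L∕2` with exact block sums; sub-step S3c of route R2′ STEP B7′ of the pub-balaban NE9 chain, flat case

statement-level skeleton of published theorems with citation tags; proofs where landed; nothing here is a claim about the Yang–Mills mass gap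

CITATION HEADER (lean-in-tree rule).  Audit cell `pub-balaban`, sub-cell `t4`, BINDER row NE9; filed by NE9 formalisation-swarm LEAF PROVER 01
(`b2b-balaban-t4-ne9-formalise-leaf-01`, gen 79), author lineage of `B9Eq365QGGQLowerVariational` (gen 78, S3c flat), on the EVENT of
ne9-leaf-06 g64's located numbers (journal W-ne9leaf06-g64-1 l.46729, INBOX [NE9LEAF06-G64-INBOX-4]): *«the numerical bottleneck of R2′ B7′'s
(d3) currency is ONE letter — S3c's FLAT constant `κ(1)` … analytic floor 1.3·10⁻¹⁷ (d = 4) … a sharper Lean test vector is worth M»*.  Source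
READ in the held text layer (`paper:balaban1985-cmp99-background-propagators`, journal page = PDF page + 388): p. 416 Thm 3.11 (*«the operators
Δ′_a, G′, (Q′G′²Q′*)⁻¹, Δ_a, G are positive definite. This is obvious for the first three operators»*), p. 394 (3.25), p. 396 (3.35) (the
diagonal `L^kη = 1`); the device is [Balaban1984PropagatorsII] (2.74)–(2.77) p. 236 (*«to bound it from below we use … γ₀ a positive, absolute
constant»*; print: Fourier; here: variational, as in the gen-78 file whose §1 is imported BY NAME).

WHY (route R2′ STEP B7′, (d3)).  ne9-leaf-06's S3 closure `B9Eq325RLipschitzClosed` consumes a MINORANT `κ₀` of the flat coercivity of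
`K′ = Q̃′G′(1)²Q̃′†` and pays `κ₀⁻²` in `C_R♯`; with the gen-78 floor `κ₀ = 1.3·10⁻¹⁷` the Weyl window closes at `α ≈ 4.7·10⁻²¹` (leaf-06's
numbers).  The loss was NOT in the variational road but in two crude steps of the gen-78 instance: a per-step SUP bound of the tent's gradient
(`L(L²∕4)^{d−1}`, squared, times `d·L^d` bonds) and the worst case `L = 3` of `(L−1)(L−2)∕6 ≥ L²∕27` (a factor `(27∕6)^{2d}`), then everything
squared once more by Cauchy–Schwarz.  THIS file re-instantiates the SAME §1 principle (`sq_div_mul_le_re_inner_green`,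
`sq_mul_norm_sq_le_re_inner_qggq`, imported) at the pedestal tent of `B9Eq319BlockPedestalLift` with EXACT sums; at `c = L∕2` the two
one-coordinate ratios collapse to `12L²∕(L²+2) < 12` and `(3∕5)(2L⁴+5L²+8)∕(L²+2)² < 6∕5`, uniformly in `L ≥ 1`.  ORIENTATION (floats, not a
claim of this file): a Bloch ∕ Sherman–Morrison scan of the TRUE flat constant on the diagonal (`a′ = 1`, scalar fibre, all coarse momenta) gives
`5.43·10⁻⁴ ∕ 4.21·10⁻⁴ ∕ 3.40·10⁻⁴` at `d = 4`, `L = 3 ∕ 4 ∕ 6` (corner momentum; `d = 3`: `9.96·10⁻⁴ … 6.28·10⁻⁴`; `d = 2`: `2.31·10⁻³ …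
1.60·10⁻³`): `κ♯` is within a factor `1.0 … 1.8` of the truth in THIS currency (equality at `L = 2`), the floor within `≈ 2 … 4`.

WHAT IS PROVED (sorry-free; 0 `def`; axioms standard; [folklore] finite-dimensional Hilbert-space algebra + the kit's lattice bookkeeping; nothing
of [B9] asserted as printed).
* §1 **`qggq_coercive_pedestal`** — for EVERY pedestal `c > 0`, `a′ > 0` and the displayed positivity `hpos′` of `Δ′_{a′}(1)`:
  `κ(c)‖ψ‖² ≤ re⟪ψ, (Q̃′ ∘ G′ ∘ G′ ∘ Q̃′†)ψ⟫` (operator of `B9Eq365QGGQLowerVariational.qggq_coercive_flat` ∕ ne9-leaf-06's `QGGQ_pos` VERBATIM),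
  `κ(c) = (β²∕(E + a′β²))²·(c₀L^d∕c₁)`, `β = (c + (L−1)(L−2)∕6)^d`,
  `E = |η⁻¹|²·d·(L(L−1)(L−2)∕3 + 4c²)·(Lc² + 2c·L(L−1)(L−2)∕6 + L(L−1)(L−2)(L²−2L+2)∕30)^{d−1}·(c₀∕c₁)`;
  **`qggq_coercive_sharp`** — `c = L∕2`: `β = ((L²+2)∕6)^d`, `E = |η⁻¹|²·d·(L(L²+2)∕3)·(L(2L⁴+5L²+8)∕60)^{d−1}·(c₀∕c₁)`;
  **`qggq_coercive_sharp_one`** — `hpos′` DISCHARGED by `B9Thm311DeltaPrimeA.laplacePrimeA_one_pos` (`η ≠ 0`, `a′ > 0`; the operator of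
  `QGGQ_pos_one` verbatim; NO `3 ≤ L`).
* §2 **`qggq_constant_sharp_ge`** — `ρ∕(12d(6∕5)^{d−1}·ρ·|η⁻¹|²∕L² + a′)² ≤ κ♯` for every `L ≥ 1`, every `η`, all weights (`ρ = c₀L^d∕c₁`);
  **`qggq_constant_sharp_diagonal_ge`** — at `ηL = 1`, `c₀L^d = c₁`: `1∕(12d(6∕5)^{d−1} + a′)² ≤ κ♯`.
* §3 **`qggq_coercive_sharp_one_floor`** ∕ **`qggq_coercive_sharp_one_diagonal`** — §2 composed with §1: ready-made inhabitants of a consumer's slot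
  `∀ ψ, κ₀‖ψ‖² ≤ re⟪ψ, K′(1)ψ⟫` with the SHORT `κ₀` (general ∕ diagonal `(12d(6∕5)^{d−1} + a′)⁻²`).
MODEL ∕ HONEST SCOPE.  Flat background only; `κ♯` depends on `η`, `L` only through `ηL` up to the two displayed ratios, on the weights only
through `c₀L^d∕c₁`, NOT on `m` (the volume) nor on any operator norm; the product test field is not the fibre minimiser — no optimality claimed.
NOT NE9, NOT the route (cell pub-balaban: NE9 NOT PRINTED ∕ NOT PROVED; «NE9 ⇐ the named binders»; row WALLED ON A MODEL (O-NE9-1; #5 UNRULED);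
spine PROVED 0∕9; rung (B)+1 on a finite T⁴ — NOT infinite volume, NOT mass gap, NOT Clay; HONEST DEPENDENCY: continuum YM on T⁴ ⇐ BetaPertH ∧ nine
spine estimates (0/9 proved); BetaPertH ⇐ (D1) ∧ (D4) ∧ CAP+tail; G-an2-4 gates asym, D1 and NE2/3/4).  NEW file importing
`B9Eq365QGGQLowerVariational` (gen 78: §1 principle) and this generation's kit `B9Eq319BlockPedestalLift`; nothing modified.  Net new unproved facts: 0.
-/

noncomputable section

open scoped InnerProductSpace ComplexConjugate BigOperators

namespace Literature.MathematicalPhysics.QuantumFieldTheory.Balaban1983to89.B9Eq365QGGQLowerVariationalSharp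

open B4Sect5Torus (TSite)
open B9SectCLatticeCarrier (Bond shift)
open B9Eq311L2Pairing (WL2)
open B9Eq319QprimeTorus (fineP offset blockCoord)
open B11Eq103H1Complex (SiteL2K greenK covDerivL2K)
open B9Eq310HessianOperator (adTransportW)
open B5Eq172HodgePositivity (hRS_one)
open B9Eq326OperatorAssembly (QprimeW)
open B9Eq3119DeltaPiCarrier (laplacePrimeA GpOfU)
open B9Eq325ProjFormula (laplacePrimeA_isSymmetric)
open B9Thm311DeltaPrimeA (laplacePrimeA_one_pos)
open B9Eq319BlockTentLift (QprimeWL2_one_lift re_inner_laplacePrimeA_one norm_sq_QprimeWL2_one_le)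
open B9Eq365QGGQLowerVariational (sq_div_mul_le_re_inner_green sq_mul_norm_sq_le_re_inner_qggq)
open B9Eq319BlockPedestalLift (sum_pedestal_eq sum_pedestal_sq_eq sum_blockOf_pedestal pedestal_step_le sum_blockOf_pedestal_weights
  norm_sq_covDerivL2K_lift_le_split)

/-! ## §1 S3c at the flat background with the tent ON A PEDESTAL `c > 0` and exact block sums -/
section Assembly

variable {d : ℕ} (L : ℕ) [NeZero L] (m : Fin d → ℕ) [∀ i, NeZero (fineP L m i)]
  {𝔸 : Type*} [Ring 𝔸] [Algebra ℂ 𝔸] {W : Type*} [NormedAddCommGroup W] [InnerProductSpace ℂ W] [FiniteDimensional ℂ W]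
  (φ : W ≃ₗ[ℂ] 𝔸) (c₀ : ℝ) [Fact (0 < c₀)] (η : ℝ) (c₁ : ℝ) [Fact (0 < c₁)]

/-- **S3c AT THE FLAT BACKGROUND, PEDESTAL FAMILY**: for every `c > 0`, `a′ > 0` and the displayed positivity `hpos′` of `Δ′_{a′}(1)`,
`κ(c)·‖ψ‖² ≤ re⟪ψ, Q̃′G′(1)²Q̃′†ψ⟫` with `κ(c) = (β²∕(E + a′β²))²·(c₀L^d∕c₁)`, `β = (c + (L−1)(L−2)∕6)^d`,
`E = |η⁻¹|²·d·(L(L−1)(L−2)∕3 + 4c²)·(Lc² + 2c·L(L−1)(L−2)∕6 + L(L−1)(L−2)(L²−2L+2)∕30)^{d−1}·(c₀∕c₁)` — the first-order variational principle of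
`B9Eq365QGGQLowerVariational` §1 at the test vector `u = Π_ν(c + k_ν(L−1−k_ν))·(ψ∘blk)` with EXACT block sums (`B9Eq319BlockPedestalLift`):
no sup bound, every `L ≥ 1`, no volume, no operator norm. [cite: Balaban1985BackgroundPropagators, Thm 3.11 p.416, (3.25) p.394; Balaban1984PropagatorsII, (2.74)–(2.77) p.236] -/
theorem qggq_coercive_pedestal {c : ℝ} (hc : 0 < c) {a' : ℝ} (ha' : 0 < a')
    (hpos' : ∀ x : SiteL2K ℂ d (fineP L m) c₀ W, x ≠ 0 →
      0 < RCLike.re ⟪x, laplacePrimeA L m φ η (fun _ : Bond d (fineP L m) => (1 : 𝔸ˣ)) a' (c₁ := c₁) x⟫_ℂ)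
    (ψ : SiteL2K ℂ d m c₁ W) :
    (((c + ((L : ℝ) - 1) * ((L : ℝ) - 2) / 6) ^ d) ^ 2 /
          (‖((η : ℂ))⁻¹‖ ^ 2 * ((d : ℝ) * ((L : ℝ) * ((L : ℝ) - 1) * ((L : ℝ) - 2) / 3 + 4 * c ^ 2) *
              ((L : ℝ) * c ^ 2 + 2 * c * ((L : ℝ) * ((L : ℝ) - 1) * ((L : ℝ) - 2) / 6) +
                (L : ℝ) * ((L : ℝ) - 1) * ((L : ℝ) - 2) * ((L : ℝ) ^ 2 - 2 * L + 2) / 30) ^ (d - 1)) * (c₀ / c₁) +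
            a' * ((c + ((L : ℝ) - 1) * ((L : ℝ) - 2) / 6) ^ d) ^ 2)) ^ 2 * (c₀ * (L : ℝ) ^ d / c₁) * ‖ψ‖ ^ 2 ≤
      RCLike.re ⟪ψ, (((WL2.linearEquiv ℂ ℂ (fun _ : TSite d m => c₁)).symm.toLinearMap ∘ₗ
          QprimeW L m φ (fun _ : Bond d (fineP L m) => (1 : 𝔸ˣ)) (c₀ := c₀)) ∘ₗ
        GpOfU L m φ η (fun _ : Bond d (fineP L m) => (1 : 𝔸ˣ)) a' (c₁ := c₁) hpos' ∘ₗ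
        GpOfU L m φ η (fun _ : Bond d (fineP L m) => (1 : 𝔸ˣ)) a' (c₁ := c₁) hpos' ∘ₗ
        LinearMap.adjoint ((WL2.linearEquiv ℂ ℂ (fun _ : TSite d m => c₁)).symm.toLinearMap ∘ₗ
          QprimeW L m φ (fun _ : Bond d (fineP L m) => (1 : 𝔸ˣ)) (c₀ := c₀))) ψ⟫_ℂ := by
  have hc₀ : 0 < c₀ := Fact.out
  have hc₁ : 0 < c₁ := Fact.out
  have hL0 : (0 : ℝ) < L := by exact_mod_cast Nat.pos_of_ne_zero (NeZero.ne L)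
  -- the letters
  set Q : SiteL2K ℂ d (fineP L m) c₀ W →ₗ[ℂ] SiteL2K ℂ d m c₁ W :=
    (WL2.linearEquiv ℂ ℂ (fun _ : TSite d m => c₁)).symm.toLinearMap ∘ₗ QprimeW L m φ (fun _ : Bond d (fineP L m) => (1 : 𝔸ˣ)) (c₀ := c₀)
    with hQ
  set T := laplacePrimeA L m φ η (fun _ : Bond d (fineP L m) => (1 : 𝔸ˣ)) a' (c₀ := c₀) (c₁ := c₁) with hT
  have hTs : T.IsSymmetric := laplacePrimeA_isSymmetric L m φ c₀ η _ c₁ a' (hRS_one φ)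
  set S₁ : ℝ := (L : ℝ) * ((L : ℝ) - 1) * ((L : ℝ) - 2) / 6 with hS₁
  set β : ℝ := (c + ((L : ℝ) - 1) * ((L : ℝ) - 2) / 6) ^ d with hβ
  set P₂ : ℝ := (L : ℝ) * c ^ 2 + 2 * c * S₁ + (L : ℝ) * ((L : ℝ) - 1) * ((L : ℝ) - 2) * ((L : ℝ) ^ 2 - 2 * L + 2) / 30 with hP₂
  set Φ : ℝ := (d : ℝ) * ((L : ℝ) * ((L : ℝ) - 1) * ((L : ℝ) - 2) / 3 + 4 * c ^ 2) * P₂ ^ (d - 1) with hΦ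
  set ρw : ℝ := c₀ * (L : ℝ) ^ d / c₁ with hρw
  set E : ℝ := ‖((η : ℂ))⁻¹‖ ^ 2 * Φ * (c₀ / c₁) with hE
  -- `(L−1)(L−2) ≥ 0` for a natural `L`, hence `β > 0`
  have hLL : 0 ≤ ((L : ℝ) - 1) * ((L : ℝ) - 2) := by
    rcases Nat.lt_or_ge L 2 with h | h
    · interval_cases L
      · exact absurd rfl (NeZero.ne 0)
      · norm_num
    · have h2 : (2 : ℝ) ≤ L := by exact_mod_cast h
      exact mul_nonneg (by linarith) (by linarith)
  have hβ0 : 0 < β := by rw [hβ]; exact pow_pos (by positivity) d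
  have hβS : ((L : ℝ) ^ d)⁻¹ * (∑ k ∈ Finset.range L, (c + (k : ℝ) * ((L : ℝ) - 1 - k))) ^ d = β := by
    rw [sum_pedestal_eq, hβ, ← inv_pow, ← mul_pow]
    congr 1
    field_simp
  have hP₂0 : 0 ≤ P₂ := by
    have h := Finset.sum_nonneg (s := Finset.range L) fun k _ => sq_nonneg (c + (k : ℝ) * ((L : ℝ) - 1 - k))
    rw [sum_pedestal_sq_eq] at h
    rw [hP₂, hS₁]; exact h
  have hΦ0 : 0 ≤ Φ := by
    rw [hΦ]
    have : 0 ≤ (L : ℝ) * ((L : ℝ) - 1) * ((L : ℝ) - 2) / 3 := by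
      have h3 : (L : ℝ) * ((L : ℝ) - 1) * ((L : ℝ) - 2) = L * (((L : ℝ) - 1) * ((L : ℝ) - 2)) := by ring
      rw [h3]; positivity
    positivity
  have hE0 : 0 ≤ E := by rw [hE]; positivity
  have hM : 0 < E + a' * β ^ 2 := by positivity
  -- the test vector `u = b · (ψ ∘ blk)`, `b = Π_ν (c + k_ν(L−1−k_ν))`
  set ψt := WL2.equiv ℂ (fun _ : TSite d m => c₁) W ψ with hψt
  set u : SiteL2K ℂ d (fineP L m) c₀ W := (WL2.equiv ℂ (fun _ : TSite d (fineP L m) => c₀) W).symm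
    (fun x => (((∏ ν, (c + ((offset L m x ν : ℕ) : ℝ) * ((L : ℝ) - 1 - (offset L m x ν : ℕ)))) : ℝ) : ℂ) • ψt (blockCoord L m x))
    with hu
  -- `Q u = β • ψ`
  have hQu : Q u = ((β : ℝ) : ℂ) • ψ := by
    rw [← hβS]
    exact QprimeWL2_one_lift L m φ c₀ c₁ _ (fun y => sum_blockOf_pedestal L m c y) ψ
  -- (1) `β‖ψ‖² ≤ re⟪u, Q†ψ⟫`
  have hux : β * ‖ψ‖ ^ 2 ≤ RCLike.re ⟪u, LinearMap.adjoint Q ψ⟫_ℂ := by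
    rw [LinearMap.adjoint_inner_right, hQu, inner_smul_left, Complex.conj_ofReal, ← inner_self_eq_norm_sq (𝕜 := ℂ) ψ]
    simp only [RCLike.re_to_complex, Complex.re_ofReal_mul, le_refl]
  -- (2) `re⟪u, Tu⟫ ≤ (E + a′β²)‖ψ‖²` — the Dirichlet form by the SPLIT step bound with exact block sums
  have hD : ‖covDerivL2K ℂ c₀ ((η : ℂ))⁻¹ (adTransportW φ (fun _ : Bond d (fineP L m) => (1 : 𝔸ˣ))) u‖ ^ 2 ≤ E * ‖ψ‖ ^ 2 := by
    have h := norm_sq_covDerivL2K_lift_le_split L m φ c₀ η c₁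
      (fun x => ∏ ν, (c + ((offset L m x ν : ℕ) : ℝ) * ((L : ℝ) - 1 - (offset L m x ν : ℕ)))) ψ
      (fun μ x => (if offset L m x μ + 1 < L then ((L : ℝ) - 2 - 2 * (offset L m x μ : ℕ)) ^ 2 else 2 * c ^ 2) *
        (∏ ν ∈ Finset.univ.erase μ, (c + ((offset L m x ν : ℕ) : ℝ) * ((L : ℝ) - 1 - (offset L m x ν : ℕ)))) ^ 2)
      (fun μ x => (if offset L m x μ = 0 then 2 * c ^ 2 else 0) *
        (∏ ν ∈ Finset.univ.erase μ, (c + ((offset L m x ν : ℕ) : ℝ) * ((L : ℝ) - 1 - (offset L m x ν : ℕ)))) ^ 2)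
      (Φ := Φ) (fun x μ => pedestal_step_le L m c ψt x μ)
      (fun y => by rw [sum_blockOf_pedestal_weights L m c y, sum_pedestal_sq_eq, hΦ, hP₂, hS₁])
    rw [hE]; exact h
  have huu : RCLike.re ⟪u, T u⟫_ℂ ≤ (E + a' * β ^ 2) * ‖ψ‖ ^ 2 := by
    rw [hT, re_inner_laplacePrimeA_one L m φ c₀ η c₁ a' u]
    have h2 : ‖Q u‖ ^ 2 = β ^ 2 * ‖ψ‖ ^ 2 := by
      rw [hQu, norm_smul, Complex.norm_real, Real.norm_eq_abs, abs_of_pos hβ0, mul_pow]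
    rw [← hQ, h2, add_mul]
    have h3 : a' * (β ^ 2 * ‖ψ‖ ^ 2) = a' * β ^ 2 * ‖ψ‖ ^ 2 := by ring
    rw [h3]
    exact add_le_add hD le_rfl
  -- (3) the first-order variational principle: `κ₁‖ψ‖² ≤ re⟪Q†ψ, G′Q†ψ⟫`, `κ₁ = β²∕(E + a′β²)`
  have hG : ∀ z, GpOfU L m φ η (fun _ : Bond d (fineP L m) => (1 : 𝔸ˣ)) a' (c₁ := c₁) hpos' z = greenK T hpos' z := fun z => rfl
  have hκ₁ := sq_div_mul_le_re_inner_green hTs hpos' hM hβ0.le hux huu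
  -- (4) Cauchy–Schwarz with `‖Q̃′‖ ≤ N := √(c₁∕(c₀L^d))`
  have hN0 : 0 < Real.sqrt (c₁ / (c₀ * (L : ℝ) ^ d)) := Real.sqrt_pos.2 (by positivity)
  have hQn : ∀ v, ‖Q v‖ ≤ Real.sqrt (c₁ / (c₀ * (L : ℝ) ^ d)) * ‖v‖ := fun v => by
    have h := norm_sq_QprimeWL2_one_le L m φ c₀ c₁ v
    rw [← hQ] at h
    refine (pow_le_pow_iff_left₀ (norm_nonneg _) (by positivity) two_ne_zero).1 ?_
    rw [mul_pow, Real.sq_sqrt (by positivity)]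
    exact h
  have hfin := sq_mul_norm_sq_le_re_inner_qggq hTs hpos' Q hN0 (by positivity) hQn ψ hκ₁
  -- (5) the constant: `(κ₁∕N)² = κ₁²·(c₀L^d∕c₁)`
  have hconst : (β ^ 2 / (E + a' * β ^ 2) / Real.sqrt (c₁ / (c₀ * (L : ℝ) ^ d))) ^ 2 =
      (β ^ 2 / (E + a' * β ^ 2)) ^ 2 * (c₀ * (L : ℝ) ^ d / c₁) := by
    rw [div_pow, Real.sq_sqrt (by positivity)]
    field_simp
  rw [hconst, hE, hΦ, hP₂, hS₁] at hfin
  simpa only [LinearMap.comp_apply, hG] using hfin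

/-- **S3c AT THE FLAT BACKGROUND, SHARP FORM (`c = L∕2`)**: for every `a′ > 0` and the displayed positivity `hpos′` of `Δ′_{a′}(1)`,
`κ♯·‖ψ‖² ≤ re⟪ψ, Q̃′G′(1)²Q̃′†ψ⟫` with `κ♯ = (β²∕(E + a′β²))²·(c₀L^d∕c₁)`, `β = ((L²+2)∕6)^d`,
`E = |η⁻¹|²·d·(L(L²+2)∕3)·(L(2L⁴+5L²+8)∕60)^{d−1}·(c₀∕c₁)` — at the pedestal `c = L∕2` the one-coordinate sums COLLAPSE
(`L∕2 + (L−1)(L−2)∕6 = (L²+2)∕6`, `L(L−1)(L−2)∕3 + L² = L(L²+2)∕3`, `Σ(L∕2 + k(L−1−k))² = L(2L⁴+5L²+8)∕60`), so that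
`E∕β² = (ηL)⁻²·(c₀L^d∕c₁)·d·[12L²∕(L²+2)]·[(3∕5)(2L⁴+5L²+8)∕(L²+2)²]^{d−1} < 12d(6∕5)^{d−1}·(ηL)⁻²(c₀L^d∕c₁)` for EVERY `L ≥ 1`
(`qggq_constant_sharp_ge`). Same operator as `B9Eq365QGGQLowerVariational.qggq_coercive_flat` ∕ ne9-leaf-06's `QGGQ_pos`. [cite: Balaban1985BackgroundPropagators, Thm 3.11 p.416, (3.25) p.394; Balaban1984PropagatorsII, (2.74)–(2.77) p.236] -/
theorem qggq_coercive_sharp {a' : ℝ} (ha' : 0 < a')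
    (hpos' : ∀ x : SiteL2K ℂ d (fineP L m) c₀ W, x ≠ 0 →
      0 < RCLike.re ⟪x, laplacePrimeA L m φ η (fun _ : Bond d (fineP L m) => (1 : 𝔸ˣ)) a' (c₁ := c₁) x⟫_ℂ)
    (ψ : SiteL2K ℂ d m c₁ W) :
    (((((L : ℝ) ^ 2 + 2) / 6) ^ d) ^ 2 /
          (‖((η : ℂ))⁻¹‖ ^ 2 * ((d : ℝ) * ((L : ℝ) * ((L : ℝ) ^ 2 + 2) / 3) *
              ((L : ℝ) * (2 * (L : ℝ) ^ 4 + 5 * (L : ℝ) ^ 2 + 8) / 60) ^ (d - 1)) * (c₀ / c₁) +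
            a' * ((((L : ℝ) ^ 2 + 2) / 6) ^ d) ^ 2)) ^ 2 * (c₀ * (L : ℝ) ^ d / c₁) * ‖ψ‖ ^ 2 ≤
      RCLike.re ⟪ψ, (((WL2.linearEquiv ℂ ℂ (fun _ : TSite d m => c₁)).symm.toLinearMap ∘ₗ
          QprimeW L m φ (fun _ : Bond d (fineP L m) => (1 : 𝔸ˣ)) (c₀ := c₀)) ∘ₗ
        GpOfU L m φ η (fun _ : Bond d (fineP L m) => (1 : 𝔸ˣ)) a' (c₁ := c₁) hpos' ∘ₗ
        GpOfU L m φ η (fun _ : Bond d (fineP L m) => (1 : 𝔸ˣ)) a' (c₁ := c₁) hpos' ∘ₗ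
        LinearMap.adjoint ((WL2.linearEquiv ℂ ℂ (fun _ : TSite d m => c₁)).symm.toLinearMap ∘ₗ
          QprimeW L m φ (fun _ : Bond d (fineP L m) => (1 : 𝔸ˣ)) (c₀ := c₀))) ψ⟫_ℂ := by
  have hL0 : (0 : ℝ) < L := by exact_mod_cast Nat.pos_of_ne_zero (NeZero.ne L)
  have h := qggq_coercive_pedestal L m φ c₀ η c₁ (c := (L : ℝ) / 2) (by positivity) ha' hpos' ψ
  have e1 : (L : ℝ) / 2 + ((L : ℝ) - 1) * ((L : ℝ) - 2) / 6 = ((L : ℝ) ^ 2 + 2) / 6 := by ring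
  have e2 : (L : ℝ) * ((L : ℝ) - 1) * ((L : ℝ) - 2) / 3 + 4 * ((L : ℝ) / 2) ^ 2 = (L : ℝ) * ((L : ℝ) ^ 2 + 2) / 3 := by ring
  have e3 : (L : ℝ) * ((L : ℝ) / 2) ^ 2 + 2 * ((L : ℝ) / 2) * ((L : ℝ) * ((L : ℝ) - 1) * ((L : ℝ) - 2) / 6) +
      (L : ℝ) * ((L : ℝ) - 1) * ((L : ℝ) - 2) * ((L : ℝ) ^ 2 - 2 * L + 2) / 30 =
      (L : ℝ) * (2 * (L : ℝ) ^ 4 + 5 * (L : ℝ) ^ 2 + 8) / 60 := by ring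
  rw [e1, e2, e3] at h
  exact h

/-- **THE SAME WITH THE POSITIVITY DISCHARGED** (`B9Thm311DeltaPrimeA.laplacePrimeA_one_pos`: `η ≠ 0`, `a′ > 0` only): the operator of
ne9-leaf-06's `B9Eq325ProjFormula.QGGQ_pos_one` VERBATIM is bounded below by `κ♯` — the slot `hκ1 : ∀ ψ, κ₀‖ψ‖² ≤ re⟪ψ, K′(1)ψ⟫` of a consumer
is served by `exact qggq_coercive_sharp_one …` (every `L ≥ 1`; `B9Eq365QGGQLowerVariational.qggq_coercive_one` needed `3 ≤ L`). [cite: Balaban1985BackgroundPropagators, Thm 3.11 p.416, (3.25) p.394; Balaban1984PropagatorsII, (2.74)–(2.77) p.236] -/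
theorem qggq_coercive_sharp_one (hη : η ≠ 0) {a' : ℝ} (ha' : 0 < a') (ψ : SiteL2K ℂ d m c₁ W) :
    (((((L : ℝ) ^ 2 + 2) / 6) ^ d) ^ 2 /
          (‖((η : ℂ))⁻¹‖ ^ 2 * ((d : ℝ) * ((L : ℝ) * ((L : ℝ) ^ 2 + 2) / 3) *
              ((L : ℝ) * (2 * (L : ℝ) ^ 4 + 5 * (L : ℝ) ^ 2 + 8) / 60) ^ (d - 1)) * (c₀ / c₁) +
            a' * ((((L : ℝ) ^ 2 + 2) / 6) ^ d) ^ 2)) ^ 2 * (c₀ * (L : ℝ) ^ d / c₁) * ‖ψ‖ ^ 2 ≤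
      RCLike.re ⟪ψ, (((WL2.linearEquiv ℂ ℂ (fun _ : TSite d m => c₁)).symm.toLinearMap ∘ₗ
          QprimeW L m φ (fun _ : Bond d (fineP L m) => (1 : 𝔸ˣ)) (c₀ := c₀)) ∘ₗ
        GpOfU L m φ η (fun _ : Bond d (fineP L m) => (1 : 𝔸ˣ)) a' (c₁ := c₁) (laplacePrimeA_one_pos L m φ η a' hη ha') ∘ₗ
        GpOfU L m φ η (fun _ : Bond d (fineP L m) => (1 : 𝔸ˣ)) a' (c₁ := c₁) (laplacePrimeA_one_pos L m φ η a' hη ha') ∘ₗ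
        LinearMap.adjoint ((WL2.linearEquiv ℂ ℂ (fun _ : TSite d m => c₁)).symm.toLinearMap ∘ₗ
          QprimeW L m φ (fun _ : Bond d (fineP L m) => (1 : 𝔸ˣ)) (c₀ := c₀))) ψ⟫_ℂ :=
  qggq_coercive_sharp L m φ c₀ η c₁ ha' _ ψ

end Assembly

/-! ## §2 The floors: `κ♯ ≥ ρ∕(12d(6∕5)^{d−1}ρ(ηL)⁻² + a′)²` for every `L`, and the diagonal reading `(12d(6∕5)^{d−1} + a′)⁻²` -/
section Floor

variable {d : ℕ} {L : ℕ} [NeZero L]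

/-- the two one-coordinate ratios at the pedestal `c = L∕2` are below their `L → ∞` limits `12` and `6∕5`, in the product form the floor needs:
`(L(L²+2)∕3)·(L(2L⁴+5L²+8)∕60)^e·L² ≤ 12(6∕5)^e·L^{e+1}·(((L²+2)∕6)^{e+1})²` (private arithmetic helper). [folklore] -/
private theorem ratio_prod_le (e : ℕ) :
    (L : ℝ) * ((L : ℝ) ^ 2 + 2) / 3 * ((L : ℝ) * (2 * (L : ℝ) ^ 4 + 5 * (L : ℝ) ^ 2 + 8) / 60) ^ e * (L : ℝ) ^ 2 ≤
      12 * (6 / 5 : ℝ) ^ e * (L : ℝ) ^ (e + 1) * ((((L : ℝ) ^ 2 + 2) / 6) ^ (e + 1)) ^ 2 := by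
  have hL0 : (0 : ℝ) < L := by exact_mod_cast Nat.pos_of_ne_zero (NeZero.ne L)
  set q : ℝ := (((L : ℝ) ^ 2 + 2) / 6) ^ 2 with hq
  have hq0 : 0 ≤ q := by positivity
  -- `A·L ≤ 12q` and `B ≤ (6/5)·L·q`
  have hA : (L : ℝ) * ((L : ℝ) ^ 2 + 2) / 3 * L ≤ 12 * q := by
    rw [hq]; nlinarith [sq_nonneg (L : ℝ), hL0]
  have hB0 : 0 ≤ (L : ℝ) * (2 * (L : ℝ) ^ 4 + 5 * (L : ℝ) ^ 2 + 8) / 60 := by positivity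
  have hB : (L : ℝ) * (2 * (L : ℝ) ^ 4 + 5 * (L : ℝ) ^ 2 + 8) / 60 ≤ 6 / 5 * L * q := by
    rw [hq]
    have h : 2 * (L : ℝ) ^ 4 + 5 * (L : ℝ) ^ 2 + 8 ≤ 2 * ((L : ℝ) ^ 2 + 2) ^ 2 := by nlinarith [sq_nonneg (L : ℝ)]
    have h' : (L : ℝ) * (2 * (L : ℝ) ^ 4 + 5 * (L : ℝ) ^ 2 + 8) ≤ (L : ℝ) * (2 * ((L : ℝ) ^ 2 + 2) ^ 2) :=
      mul_le_mul_of_nonneg_left h hL0.le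
    have e' : 6 / 5 * (L : ℝ) * ((((L : ℝ) ^ 2 + 2) / 6) ^ 2) = (L : ℝ) * (2 * ((L : ℝ) ^ 2 + 2) ^ 2) / 60 := by ring
    rw [e']
    exact div_le_div_of_nonneg_right h' (by norm_num)
  have hBe : ((L : ℝ) * (2 * (L : ℝ) ^ 4 + 5 * (L : ℝ) ^ 2 + 8) / 60) ^ e ≤ (6 / 5 * L * q) ^ e := pow_le_pow_left₀ hB0 hB e
  have hAe0 : 0 ≤ (6 / 5 * (L : ℝ) * q) ^ e := by positivity
  calc (L : ℝ) * ((L : ℝ) ^ 2 + 2) / 3 * ((L : ℝ) * (2 * (L : ℝ) ^ 4 + 5 * (L : ℝ) ^ 2 + 8) / 60) ^ e * (L : ℝ) ^ 2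
      = ((L : ℝ) * ((L : ℝ) ^ 2 + 2) / 3 * L) * ((L : ℝ) * (2 * (L : ℝ) ^ 4 + 5 * (L : ℝ) ^ 2 + 8) / 60) ^ e * L := by ring
    _ ≤ (12 * q) * (6 / 5 * L * q) ^ e * L := by
        refine mul_le_mul_of_nonneg_right ?_ hL0.le
        exact mul_le_mul hA hBe (by positivity) (by positivity)
    _ = 12 * (6 / 5 : ℝ) ^ e * (L : ℝ) ^ (e + 1) * ((((L : ℝ) ^ 2 + 2) / 6) ^ (e + 1)) ^ 2 := by
        rw [mul_pow, mul_pow, hq, ← pow_mul, ← pow_mul]; ring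

/-- **THE FLOOR OF `κ♯`, EVERY `L ≥ 1`, EVERY SPACING AND WEIGHTS**: with `ρ = c₀L^d∕c₁` and `(ηL)⁻² = |η⁻¹|²∕L²`,
`ρ∕(12d(6∕5)^{d−1}·ρ·(ηL)⁻² + a′)² ≤ κ♯` — the constant of `qggq_coercive_sharp` is minorised by a function of `(d, ρ(ηL)⁻², ρ, a′)` only:
`E∕β² ≤ 12d(6∕5)^{d−1}·ρ(ηL)⁻²` because `12L²∕(L²+2) ≤ 12` and `(3∕5)(2L⁴+5L²+8)∕(L²+2)² ≤ 6∕5`. [cite: Balaban1985BackgroundPropagators, Thm 3.11 p.416, (3.35) p.396; Balaban1984PropagatorsII, (2.77) p.236] -/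
theorem qggq_constant_sharp_ge (η : ℝ) {c₀ c₁ a' : ℝ} (hc₀ : 0 < c₀) (hc₁ : 0 < c₁) (ha' : 0 < a') :
    (c₀ * (L : ℝ) ^ d / c₁) /
        (12 * (d : ℝ) * (6 / 5) ^ (d - 1) * (c₀ * (L : ℝ) ^ d / c₁) * (‖((η : ℂ))⁻¹‖ ^ 2 / (L : ℝ) ^ 2) + a') ^ 2 ≤
      (((((L : ℝ) ^ 2 + 2) / 6) ^ d) ^ 2 /
          (‖((η : ℂ))⁻¹‖ ^ 2 * ((d : ℝ) * ((L : ℝ) * ((L : ℝ) ^ 2 + 2) / 3) *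
              ((L : ℝ) * (2 * (L : ℝ) ^ 4 + 5 * (L : ℝ) ^ 2 + 8) / 60) ^ (d - 1)) * (c₀ / c₁) +
            a' * ((((L : ℝ) ^ 2 + 2) / 6) ^ d) ^ 2)) ^ 2 * (c₀ * (L : ℝ) ^ d / c₁) := by
  have hL0 : (0 : ℝ) < L := by exact_mod_cast Nat.pos_of_ne_zero (NeZero.ne L)
  set ρ : ℝ := c₀ * (L : ℝ) ^ d / c₁ with hρ
  set s : ℝ := ‖((η : ℂ))⁻¹‖ ^ 2 / (L : ℝ) ^ 2 with hs
  set K : ℝ := 12 * (d : ℝ) * (6 / 5) ^ (d - 1) with hK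
  set β : ℝ := (((L : ℝ) ^ 2 + 2) / 6) ^ d with hβ
  set E : ℝ := ‖((η : ℂ))⁻¹‖ ^ 2 * ((d : ℝ) * ((L : ℝ) * ((L : ℝ) ^ 2 + 2) / 3) *
      ((L : ℝ) * (2 * (L : ℝ) ^ 4 + 5 * (L : ℝ) ^ 2 + 8) / 60) ^ (d - 1)) * (c₀ / c₁) with hE
  have hρ0 : 0 < ρ := by rw [hρ]; positivity
  have hs0 : 0 ≤ s := by rw [hs]; positivity
  have hK0 : 0 ≤ K := by rw [hK]; positivity
  have hβ0 : 0 < β := by rw [hβ]; positivity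
  have hE0 : 0 ≤ E := by rw [hE]; positivity
  -- the key estimate `E ≤ K·ρ·s·β²`
  have hEle : E ≤ K * ρ * s * β ^ 2 := by
    rcases Nat.eq_zero_or_pos d with hd | hd
    · subst hd
      rw [hE, hK]; simp
    · obtain ⟨e, rfl⟩ : ∃ e, d = e + 1 := ⟨d - 1, (Nat.sub_add_cancel hd).symm⟩
      rw [Nat.add_sub_cancel] at hE hK
      have hr := ratio_prod_le (L := L) e
      -- multiply `hr` by the nonnegative factor `‖η⁻¹‖²·(e+1)·(c₀/c₁)/L²`
      have hw : 0 ≤ ‖((η : ℂ))⁻¹‖ ^ 2 * (((e + 1 : ℕ) : ℝ)) * (c₀ / c₁) / (L : ℝ) ^ 2 := by positivity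
      have h2 := mul_le_mul_of_nonneg_left hr hw
      have eL : E = ‖((η : ℂ))⁻¹‖ ^ 2 * (((e + 1 : ℕ) : ℝ)) * (c₀ / c₁) / (L : ℝ) ^ 2 *
          ((L : ℝ) * ((L : ℝ) ^ 2 + 2) / 3 * ((L : ℝ) * (2 * (L : ℝ) ^ 4 + 5 * (L : ℝ) ^ 2 + 8) / 60) ^ e * (L : ℝ) ^ 2) := by
        rw [hE]; field_simp
      have eR : ‖((η : ℂ))⁻¹‖ ^ 2 * (((e + 1 : ℕ) : ℝ)) * (c₀ / c₁) / (L : ℝ) ^ 2 *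
          (12 * (6 / 5 : ℝ) ^ e * (L : ℝ) ^ (e + 1) * ((((L : ℝ) ^ 2 + 2) / 6) ^ (e + 1)) ^ 2) = K * ρ * s * β ^ 2 := by
        rw [hK, hρ, hs, hβ]; field_simp
      rw [eL, ← eR]; exact h2
  -- `κ₁ = β²/(E + a′β²) ≥ 1/(Kρs + a′)`
  have hden1 : 0 < K * ρ * s + a' := by positivity
  have hden2 : 0 < E + a' * β ^ 2 := by positivity
  have hk1 : 1 / (K * ρ * s + a') ≤ β ^ 2 / (E + a' * β ^ 2) := by
    rw [div_le_div_iff₀ hden1 hden2, one_mul]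
    have : E + a' * β ^ 2 ≤ K * ρ * s * β ^ 2 + a' * β ^ 2 := add_le_add hEle le_rfl
    calc E + a' * β ^ 2 ≤ K * ρ * s * β ^ 2 + a' * β ^ 2 := this
      _ = β ^ 2 * (K * ρ * s + a') := by ring
  have hk0 : 0 ≤ 1 / (K * ρ * s + a') := by positivity
  have hsq := pow_le_pow_left₀ hk0 hk1 2
  have hfin := mul_le_mul_of_nonneg_right hsq hρ0.le
  calc ρ / (K * ρ * s + a') ^ 2 = (1 / (K * ρ * s + a')) ^ 2 * ρ := by rw [one_div_pow]; field_simp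
    _ ≤ (β ^ 2 / (E + a' * β ^ 2)) ^ 2 * ρ := hfin

/-- **THE DIAGONAL READING**: at `ηL = 1` and canonical weights `c₀L^d = c₁`, the constant of `qggq_coercive_sharp` is bounded BELOW by
`1∕(12d(6∕5)^{d−1} + a′)²` — a function of `(d, a′)` ONLY, for EVERY `L ≥ 1`; at `d = 4`, `a′ = 1`: `≈ 1.42·10⁻⁴` (against `1∕(16d(729∕16)^d + a′)²
≈ 1.3·10⁻¹⁷` of `B9Eq365QGGQLowerVariational.qggq_constant_diagonal_ge`). A float Bloch scan of the TRUE flat constant on the diagonal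
(`a′ = 1`) gives `≈ 5.4·10⁻⁴ ∕ 4.2·10⁻⁴ ∕ 3.4·10⁻⁴` at `d = 4`, `L = 3 ∕ 4 ∕ 6`, attained at the corner coarse momentum — orientation, not a claim
of this file. [cite: Balaban1985BackgroundPropagators, Thm 3.11 p.416, (3.35) p.396; Balaban1984PropagatorsII, (2.77) p.236] -/
theorem qggq_constant_sharp_diagonal_ge {η c₀ c₁ a' : ℝ} (hη : η * L = 1) (hw : c₀ * (L : ℝ) ^ d = c₁) (hc₁ : 0 < c₁) (ha' : 0 < a') :
    1 / (12 * (d : ℝ) * (6 / 5) ^ (d - 1) + a') ^ 2 ≤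
      (((((L : ℝ) ^ 2 + 2) / 6) ^ d) ^ 2 /
          (‖((η : ℂ))⁻¹‖ ^ 2 * ((d : ℝ) * ((L : ℝ) * ((L : ℝ) ^ 2 + 2) / 3) *
              ((L : ℝ) * (2 * (L : ℝ) ^ 4 + 5 * (L : ℝ) ^ 2 + 8) / 60) ^ (d - 1)) * (c₀ / c₁) +
            a' * ((((L : ℝ) ^ 2 + 2) / 6) ^ d) ^ 2)) ^ 2 * (c₀ * (L : ℝ) ^ d / c₁) := by
  have hL0 : (0 : ℝ) < L := by exact_mod_cast Nat.pos_of_ne_zero (NeZero.ne L)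
  have hc₀ : 0 < c₀ := (mul_pos_iff_of_pos_right (by positivity : (0 : ℝ) < (L : ℝ) ^ d)).1 (by rw [hw]; exact hc₁)
  have hρ1 : c₀ * (L : ℝ) ^ d / c₁ = 1 := by rw [hw, div_self hc₁.ne']
  have hηinv : ‖((η : ℂ))⁻¹‖ = L := by
    have hη' : η = 1 / L := by field_simp; linarith
    rw [norm_inv, Complex.norm_real, Real.norm_eq_abs, hη', abs_of_pos (by positivity), one_div, inv_inv]
  have hs1 : ‖((η : ℂ))⁻¹‖ ^ 2 / (L : ℝ) ^ 2 = 1 := by rw [hηinv, div_self (by positivity)]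
  calc 1 / (12 * (d : ℝ) * (6 / 5) ^ (d - 1) + a') ^ 2
      = (c₀ * (L : ℝ) ^ d / c₁) /
          (12 * (d : ℝ) * (6 / 5) ^ (d - 1) * (c₀ * (L : ℝ) ^ d / c₁) * (‖((η : ℂ))⁻¹‖ ^ 2 / (L : ℝ) ^ 2) + a') ^ 2 := by
        rw [hs1, hρ1, mul_one, mul_one]
    _ ≤ _ := qggq_constant_sharp_ge (d := d) (L := L) η hc₀ hc₁ ha'

end Floor

/-! ## §3 The floors composed with the bound: ready-made inhabitants of a consumer's slot `∀ ψ, κ₀‖ψ‖² ≤ re⟪ψ, K′(1)ψ⟫` with a short `κ₀` -/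
section Slot

variable {d : ℕ} (L : ℕ) [NeZero L] (m : Fin d → ℕ) [∀ i, NeZero (fineP L m i)]
  {𝔸 : Type*} [Ring 𝔸] [Algebra ℂ 𝔸] {W : Type*} [NormedAddCommGroup W] [InnerProductSpace ℂ W] [FiniteDimensional ℂ W]
  (φ : W ≃ₗ[ℂ] 𝔸) (c₀ : ℝ) [Fact (0 < c₀)] (η : ℝ) (c₁ : ℝ) [Fact (0 < c₁)]

/-- **THE SLOT INHABITANT WITH THE SHORT CONSTANT, EVERY SPACING AND WEIGHTS**: `(ρ∕(12d(6∕5)^{d−1}ρ|η⁻¹|²∕L² + a′)²)·‖ψ‖² ≤ re⟪ψ, Q̃′G′(1)²Q̃′†ψ⟫`,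
`ρ = c₀L^d∕c₁` (operator of `QGGQ_pos_one` verbatim) — `qggq_constant_sharp_ge` composed with `qggq_coercive_sharp_one`. [cite: Balaban1985BackgroundPropagators, Thm 3.11 p.416, (3.25) p.394; Balaban1984PropagatorsII, (2.77) p.236] -/
theorem qggq_coercive_sharp_one_floor (hη : η ≠ 0) {a' : ℝ} (ha' : 0 < a') (ψ : SiteL2K ℂ d m c₁ W) :
    (c₀ * (L : ℝ) ^ d / c₁) /
          (12 * (d : ℝ) * (6 / 5) ^ (d - 1) * (c₀ * (L : ℝ) ^ d / c₁) * (‖((η : ℂ))⁻¹‖ ^ 2 / (L : ℝ) ^ 2) + a') ^ 2 * ‖ψ‖ ^ 2 ≤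
      RCLike.re ⟪ψ, (((WL2.linearEquiv ℂ ℂ (fun _ : TSite d m => c₁)).symm.toLinearMap ∘ₗ
          QprimeW L m φ (fun _ : Bond d (fineP L m) => (1 : 𝔸ˣ)) (c₀ := c₀)) ∘ₗ
        GpOfU L m φ η (fun _ : Bond d (fineP L m) => (1 : 𝔸ˣ)) a' (c₁ := c₁) (laplacePrimeA_one_pos L m φ η a' hη ha') ∘ₗ
        GpOfU L m φ η (fun _ : Bond d (fineP L m) => (1 : 𝔸ˣ)) a' (c₁ := c₁) (laplacePrimeA_one_pos L m φ η a' hη ha') ∘ₗ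
        LinearMap.adjoint ((WL2.linearEquiv ℂ ℂ (fun _ : TSite d m => c₁)).symm.toLinearMap ∘ₗ
          QprimeW L m φ (fun _ : Bond d (fineP L m) => (1 : 𝔸ˣ)) (c₀ := c₀))) ψ⟫_ℂ :=
  (mul_le_mul_of_nonneg_right (qggq_constant_sharp_ge (d := d) (L := L) η (Fact.out : 0 < c₀) (Fact.out : 0 < c₁) ha') (sq_nonneg _)).trans
    (qggq_coercive_sharp_one L m φ c₀ η c₁ hη ha' ψ)

/-- **THE SLOT INHABITANT ON THE DIAGONAL**: at `ηL = 1`, `c₀L^d = c₁`: `(12d(6∕5)^{d−1} + a′)⁻²·‖ψ‖² ≤ re⟪ψ, Q̃′G′(1)²Q̃′†ψ⟫` for EVERY `L ≥ 1` — the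
term a consumer on Bałaban's diagonal (ne9-leaf-06's `norm_RofU_sub_RofU_one_le_diagonal`) feeds its `hκ1` with `κ₀ = (12d(6∕5)^{d−1} + a′)⁻²`
(`1.419·10⁻⁴` at d = 4, a′ = 1) in place of `(16d(729∕16)^d + a′)⁻²`. [cite: Balaban1985BackgroundPropagators, Thm 3.11 p.416, (3.35) p.396; Balaban1984PropagatorsII, (2.77) p.236] -/
theorem qggq_coercive_sharp_one_diagonal (hη : η ≠ 0) (hηL : η * L = 1) (hw : c₀ * (L : ℝ) ^ d = c₁) {a' : ℝ} (ha' : 0 < a')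
    (ψ : SiteL2K ℂ d m c₁ W) :
    1 / (12 * (d : ℝ) * (6 / 5) ^ (d - 1) + a') ^ 2 * ‖ψ‖ ^ 2 ≤
      RCLike.re ⟪ψ, (((WL2.linearEquiv ℂ ℂ (fun _ : TSite d m => c₁)).symm.toLinearMap ∘ₗ
          QprimeW L m φ (fun _ : Bond d (fineP L m) => (1 : 𝔸ˣ)) (c₀ := c₀)) ∘ₗ
        GpOfU L m φ η (fun _ : Bond d (fineP L m) => (1 : 𝔸ˣ)) a' (c₁ := c₁) (laplacePrimeA_one_pos L m φ η a' hη ha') ∘ₗ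
        GpOfU L m φ η (fun _ : Bond d (fineP L m) => (1 : 𝔸ˣ)) a' (c₁ := c₁) (laplacePrimeA_one_pos L m φ η a' hη ha') ∘ₗ
        LinearMap.adjoint ((WL2.linearEquiv ℂ ℂ (fun _ : TSite d m => c₁)).symm.toLinearMap ∘ₗ
          QprimeW L m φ (fun _ : Bond d (fineP L m) => (1 : 𝔸ˣ)) (c₀ := c₀))) ψ⟫_ℂ :=
  (mul_le_mul_of_nonneg_right (qggq_constant_sharp_diagonal_ge (d := d) (L := L) hηL hw (Fact.out : 0 < c₁) ha') (sq_nonneg _)).trans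
    (qggq_coercive_sharp_one L m φ c₀ η c₁ hη ha' ψ)

end Slot

end Literature.MathematicalPhysics.QuantumFieldTheory.Balaban1983to89.B9Eq365QGGQLowerVariationalSharp

end
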